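import Summits.QuantumFields.QCD.Theses.SpectralDefectExtinction
import Literature.Barriers.QuantumFields.WilsonDeterminantSign
import Literature.MathematicalPhysics.QuantumLattice.OverlapLocality
import Literature.MathematicalPhysics.QuantumLattice.WilsonDiracRangeOne
import Literature.MathematicalPhysics.QuantumFieldTheory.QCD

/-!
# Stub `stub_badBoxLocal` of line `block-away-the-sign`
(crux `Summit.QuantumFields.QCD.Theses.SpectralDefectExtinction.ExtinctionBuildsQCD`, item stmt-QuantumFields-18064)

LOCALITY OF THE BAD-BOX TEST (sparse-window-wells module, stub W4).  Whether the taxi ball of radius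
`r` about `x₀` supports a nonzero quasi-mode of `H = Γ₅ D_W(·, m₀, 1)` strictly below level `E`
depends only on the link variables based within taxi distance `r + 1` of `x₀`.

Proof.  The Wilson–Dirac matrix has range one: the entry `D_W(U) p q` is the mass/Wilson diagonal
term (no link) plus, for `q.1 = p.1 + μ̂`, a forward hop reading the link `U (p.1, μ)` and, for
`p.1 = q.1 + μ̂`, a backward hop reading `U (q.1, μ)`.  If `dist(q.1, x₀) ≤ r` both links are based
within taxi distance `r + 1` of `x₀` (the taxi distance changes by at most one along a link), so the
`q`-th columns of `D_W(U)` and `D_W(V)` agree whenever `U = V` on those links; hence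
`D_W(U) φ = D_W(V) φ` for every `φ` supported in the ball, and `Γ₅ = 1 ⊗ 1 ⊗ γ₅` does not involve
the gauge field at all.  The two existential statements are then literally the same.
-/

noncomputable section

namespace Summit.QuantumFields.QCD.Cruxes.ExtinctionBuildsQCD.BlockAwayTheSign

open scoped BigOperators Topology Classical MeasureTheory Matrix
open Filter MeasureTheory Matrix
open Literature.MathematicalPhysics.QuantumLattice Literature.MathematicalPhysics.AQFT
  Literature.MathematicalPhysics.QuantumFieldTheory Literature.Probability.LatticeModels
open Literature.Barriers.QuantumFields.WilsonDeterminant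
open Summit.QuantumFields.QCD.Theses.SpectralDefectExtinction
open Summit.QuantumFields.QCD.Theses

/-! ## Locality of the Wilson–Dirac matrix in the gauge field -/

section Locality

variable {L N : ℕ} [NeZero L] {G : Type*} [Group G] (ρ : G →* Matrix (Fin N) (Fin N) ℂ)

/-- Triangle inequality for the periodic taxi distance on the four-torus (the `ℓ¹` torus distance
`torusDistOne` with equal sides). -/
theorem badBoxLocal_torusTaxiDist_triangle (x y z : TorusSite 4 L) :
    torusTaxiDist x z ≤ torusTaxiDist x y + torusTaxiDist y z :=
  torusDistOne_triangle (Ls := fun _ : Fin 4 => L) x y z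

/-- A site is within taxi distance `dist(x + μ̂, x₀) + 1` of `x₀`. -/
theorem badBoxLocal_torusTaxiDist_le_shift_succ (x x₀ : TorusSite 4 L) (μ : Fin 4) :
    torusTaxiDist x x₀ ≤ torusTaxiDist (Site.shift x μ) x₀ + 1 := by
  have h1 : torusTaxiDist x (Site.shift x μ) ≤ 1 := by
    rw [torusTaxiDist_comm]
    exact torusTaxiDist_add_single_le_one x μ
  have h2 := badBoxLocal_torusTaxiDist_triangle x (Site.shift x μ) x₀
  omega

/-- **Columns of `D_W` near `x₀` only read nearby links.**  If two gauge fields agree on every link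
based within taxi distance `R + 1` of `x₀`, then their Wilson–Dirac matrices have the same entries
`(p, q)` for every column index `q` within taxi distance `R` of `x₀`. -/
theorem wilsonDirac_apply_eq_of_links_agree (U V : GaugeConfig 4 L G) (m r : ℝ)
    (x₀ : TorusSite 4 L) (R : ℕ)
    (hUV : ∀ e : TorusSite 4 L × Fin 4, torusTaxiDist e.1 x₀ ≤ R + 1 → U e = V e)
    (p q : TorusSite 4 L × Fin N × Fin 4) (hq : torusTaxiDist q.1 x₀ ≤ R) :
    wilsonDirac ρ U m r p q = wilsonDirac ρ V m r p q := by
  simp only [wilsonDirac, Matrix.of_apply]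
  congr 2
  refine Finset.sum_congr rfl fun μ _ => ?_
  congr 1
  · split_ifs with h
    · have hp : torusTaxiDist p.1 x₀ ≤ R + 1 := by
        have := badBoxLocal_torusTaxiDist_le_shift_succ p.1 x₀ μ
        rw [← h] at this
        omega
      rw [hUV (p.1, μ) hp]
    · rfl
  · split_ifs with h
    · rw [hUV (q.1, μ) (by simpa using Nat.le_succ_of_le hq)]
    · rfl

/-- **`D_W(U) φ = D_W(V) φ` on vectors supported near `x₀`.**  If `U = V` on the links based
within taxi distance `R + 1` of `x₀` and `φ` vanishes outside the taxi ball of radius `R` about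
`x₀`, then `D_W(U, m, r) φ = D_W(V, m, r) φ`. -/
theorem wilsonDirac_mulVec_eq_of_links_agree (U V : GaugeConfig 4 L G) (m r : ℝ)
    (x₀ : TorusSite 4 L) (R : ℕ)
    (hUV : ∀ e : TorusSite 4 L × Fin 4, torusTaxiDist e.1 x₀ ≤ R + 1 → U e = V e)
    (φ : TorusSite 4 L × Fin N × Fin 4 → ℂ) (hφ : ∀ p, R < torusTaxiDist p.1 x₀ → φ p = 0) :
    wilsonDirac ρ U m r *ᵥ φ = wilsonDirac ρ V m r *ᵥ φ := by
  funext p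
  simp only [Matrix.mulVec, dotProduct]
  refine Finset.sum_congr rfl fun q _ => ?_
  by_cases hq : torusTaxiDist q.1 x₀ ≤ R
  · rw [wilsonDirac_apply_eq_of_links_agree ρ U V m r x₀ R hUV p q hq]
  · rw [hφ q (not_le.mp hq), mul_zero, mul_zero]

/-- **`Γ₅ D_W(U) φ = Γ₅ D_W(V) φ` on vectors supported near `x₀`** (`Γ₅ = 1 ⊗ 1 ⊗ γ₅` is
field-independent). -/
theorem hermitianWilsonDirac_mulVec_eq_of_links_agree (U V : GaugeConfig 4 L G) (m r : ℝ)
    (x₀ : TorusSite 4 L) (R : ℕ)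
    (hUV : ∀ e : TorusSite 4 L × Fin 4, torusTaxiDist e.1 x₀ ≤ R + 1 → U e = V e)
    (φ : Idx L N → ℂ) (hφ : ∀ p, R < torusTaxiDist p.1 x₀ → φ p = 0) :
    hermitianWilsonDirac ρ U m r *ᵥ φ = hermitianWilsonDirac ρ V m r *ᵥ φ := by
  simp only [hermitianWilsonDirac, ← Matrix.mulVec_mulVec,
    wilsonDirac_mulVec_eq_of_links_agree ρ U V m r x₀ R hUV φ hφ]

end Locality

/-! ## The stub -/

/-- **Stub W4 (`stub_badBoxLocal`) — the bad-box test is LOCAL in the gauge field.** Whether the ball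
of taxi radius `r` about `x₀` supports a nonzero quasi-mode of `Γ₅ D_W(·, m₀, 1)` strictly below level
`E` depends only on the links based within taxi distance `r + 1` of `x₀` (range one of `D_W`). -/
theorem stub_badBoxLocal : ∀ {S : ℕ} (U V : GaugeConfig 4 (2 * S + 1) SU3) (m₀ E : ℝ) (x₀ : TorusSite 4 (2 * S + 1)) (r : ℕ), (∀ e : TorusSite 4 (2 * S + 1) × Fin 4, torusTaxiDist e.1 x₀ ≤ r + 1 → U e = V e) → ((∃ φ : Idx (2 * S + 1) 3 → ℂ, φ ≠ 0 ∧ (∀ p, r < torusTaxiDist p.1 x₀ → φ p = 0) ∧ ∑ p, ‖(hermitianWilsonDirac (fundamentalRep (Fin 3)) U m₀ 1 *ᵥ φ) p‖ ^ 2 < E ^ 2 * ∑ p, ‖φ p‖ ^ 2) ↔ (∃ φ : Idx (2 * S + 1) 3 → ℂ, φ ≠ 0 ∧ (∀ p, r < torusTaxiDist p.1 x₀ → φ p = 0) ∧ ∑ p, ‖(hermitianWilsonDirac (fundamentalRep (Fin 3)) V m₀ 1 *ᵥ φ) p‖ ^ 2 < E ^ 2 * ∑ p, ‖φ p‖ ^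 2)) := by
  intro S U V m₀ E x₀ r hUV
  have key : ∀ φ : Idx (2 * S + 1) 3 → ℂ, (∀ p, r < torusTaxiDist p.1 x₀ → φ p = 0) →
      hermitianWilsonDirac (fundamentalRep (Fin 3)) U m₀ 1 *ᵥ φ =
        hermitianWilsonDirac (fundamentalRep (Fin 3)) V m₀ 1 *ᵥ φ := fun φ hφ =>
    hermitianWilsonDirac_mulVec_eq_of_links_agree (fundamentalRep (Fin 3)) U V m₀ 1 x₀ r hUV φ hφ
  constructor
  · rintro ⟨φ, h0, hs, hlt⟩
    exact ⟨φ, h0, hs, by rwa [← key φ hs]⟩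
  · rintro ⟨φ, h0, hs, hlt⟩
    exact ⟨φ, h0, hs, by rwa [key φ hs]⟩

end Summit.QuantumFields.QCD.Cruxes.ExtinctionBuildsQCD.BlockAwayTheSign

end
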